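import Summits.SmoothPoincare4.SmoothPoincare4.Theorems.SymplecticOrigamiOrigamiFoldExistenceStubCleanOnePleatIroningFoldKernel
import Literature.Topology.FourManifolds.Isotopy
import Mathlib.Analysis.SpecialFunctions.SmoothTransition
import Mathlib.Geometry.Manifold.Instances.Sphere

/-!
# Stub `stub_cleanOnePleatIroning` of line `shadow-pleats` for crux `OrigamiFoldExistence` — VI:
# the radial isotopy of a pleat chart (item stmt-SmoothPoincare4-7844, route SymplecticOrigami; seat c3, S5a worker)

Sixth helper file for the registered stub `stub_cleanOnePleatIroning` (S5a), step (S1) of the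
SMOOTH HALF of its remaining ingredient `CleanPleatIroningChart` (file III): for a single-pleat
position `(ι, δ, e)` whose chart shadow `G = proj5 ∘ ι ∘ e 0` is injective on every sphere
`S_r`, `r₀ ≤ r ≤ R` (`0 < r₀`; for a CLEAN pleat this holds for all `0 < r₀ ≤ R ≤ 2 + ε`,
`injOn_sphere_of_isCleanPleat`), the concentric spheres

  `t ↦ (x ↦ G (radius r₀ R t • x)) : S³ → ℝ⁴`,   `radius r₀ R t = r₀ + (R - r₀) smoothTransition t`,

form a `Literature.Topology.FourManifolds.SmoothIsotopy` of EMBEDDINGS `S³ ↪ ℝ⁴`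
(`smoothIsotopy_radial`) — also across the fold radii `r = 1, 2`, where `G` is not an immersion
of `ℝ⁴` but its restriction to the sphere still is, because the fold kernel is transverse to
the fold sphere (file IV, `eq_zero_of_fderiv_chartShadow_eq_zero`).  Hence the crease
`G(S_R)` is smoothly isotopic in `ℝ⁴` to the tiny sphere `G(S_{r₀})` bounding the standard
ball `G(B̄_{r₀})` (`r₀ < 1`: `G` is an embedding of the closed unit ball's interior), and the
tree's `exists_diffeomorph_comp_eq_of_smoothIsotopy_euclidean` (`EuclideanIsotopyExtension`)
applies: step (S2).

* `radius`, `radialSphere` and their calculus; `injective_mfderiv_radialSphere` (a tangent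
  vector of `S³` killed by `d(G ∘ r•)` is orthogonal to the point, hence zero by the kernel
  hypothesis); `isSmoothEmbedding_radialSphere` (Hirsch's criterion on the compact `S³`);
* `chartShadow_kernel` — the kernel hypothesis for the chart of a `1`-pleat position, at every
  `u ≠ 0`: off the fold spheres the chart shadow is immersive (clause 6), on them file IV;
* `smoothIsotopy_radial` (registered sub-goal) and `injOn_sphere_of_isCleanPleat`.

Sources: Hirsch, *Differential Topology* (1976) Ch. 8 §1; Disproof.lean §7c; file III roadmap.
-/

noncomputable section

-- the prescribed namespace `Summit.<P>.<Sub>.…` duplicates `SmoothPoincare4` (P = Sub)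
set_option linter.dupNamespace false

open scoped Manifold ContDiff Topology RealInnerProductSpace
open Set Function Filter Metric

namespace Summit.SmoothPoincare4.SmoothPoincare4.Theorems.OrigamiFoldExistence.ShadowPleats

/-- `finrank ℝ ℝ⁴ = 3 + 1`, the `Fact` Mathlib's sphere instances for `S³ ⊂ ℝ⁴` key on. -/
instance factFinrankFour : Fact (Module.finrank ℝ (EuclideanSpace ℝ (Fin 4)) = 3 + 1) :=
  ⟨by simp⟩

/-! ### The radius schedule and the stage maps -/

/-- The RADIUS SCHEDULE `r₀ + (R - r₀) · smoothTransition t`: smooth, `r₀` for `t ≤ 0`, `R` for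
`t ≥ 1`, always in `[r₀, R]` (for `r₀ ≤ R`). -/
def radius (r₀ R t : ℝ) : ℝ := r₀ + (R - r₀) * Real.smoothTransition t

/-- The schedule starts at `r₀`. -/
@[simp] theorem radius_zero (r₀ R : ℝ) : radius r₀ R 0 = r₀ := by simp [radius]

/-- The schedule ends at `R`. -/
@[simp] theorem radius_one (r₀ R : ℝ) : radius r₀ R 1 = R := by simp [radius]

/-- The schedule stays in `[r₀, R]`. -/
theorem radius_mem_Icc {r₀ R : ℝ} (h : r₀ ≤ R) (t : ℝ) : radius r₀ R t ∈ Icc r₀ R := by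
  have h0 := Real.smoothTransition.nonneg t
  have h1 := Real.smoothTransition.le_one t
  constructor
  · unfold radius; nlinarith
  · unfold radius; nlinarith

/-- The schedule is smooth. -/
theorem contDiff_radius (r₀ R : ℝ) : ContDiff ℝ ∞ (radius r₀ R) := by
  unfold radius
  exact contDiff_const.add (contDiff_const.mul Real.smoothTransition.contDiff)

/-- The STAGE MAP at radius `r`: `x ↦ G (r • x)` on the unit sphere `S³ ⊂ ℝ⁴`. -/
def radialSphere (G : EuclideanSpace ℝ (Fin 4) → EuclideanSpace ℝ (Fin 4)) (r : ℝ)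
    (x : Metric.sphere (0 : EuclideanSpace ℝ (Fin 4)) 1) : EuclideanSpace ℝ (Fin 4) :=
  G (r • (x : EuclideanSpace ℝ (Fin 4)))

section Stage

variable {G : EuclideanSpace ℝ (Fin 4) → EuclideanSpace ℝ (Fin 4)}

/-- The inclusion of the unit `3`-sphere is smooth. -/
theorem contMDiff_val_sphere3 :
    ContMDiff (𝓡 3) 𝓘(ℝ, EuclideanSpace ℝ (Fin 4)) ∞
      (Subtype.val : Metric.sphere (0 : EuclideanSpace ℝ (Fin 4)) 1 → EuclideanSpace ℝ (Fin 4)) :=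
  contMDiff_coe_sphere

/-- Joint smoothness of `(t, x) ↦ G (ρ t • x)` for smooth `G` and a smooth schedule `ρ`. -/
theorem contMDiff_uncurry_radialSphere (hG : ContDiff ℝ ∞ G) {ρ : ℝ → ℝ} (hρ : ContDiff ℝ ∞ ρ) :
    ContMDiff (𝓘(ℝ, ℝ).prod (𝓡 3)) (𝓡 4) ∞
      (uncurry fun t x => radialSphere G (ρ t) x) := by
  have h1 : ContMDiff (𝓘(ℝ, ℝ).prod (𝓡 3)) 𝓘(ℝ, ℝ) ∞
      (fun p : ℝ × Metric.sphere (0 : EuclideanSpace ℝ (Fin 4)) 1 => ρ p.1) :=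
    hρ.contMDiff.comp contMDiff_fst
  have h2 : ContMDiff (𝓘(ℝ, ℝ).prod (𝓡 3)) 𝓘(ℝ, EuclideanSpace ℝ (Fin 4)) ∞
      (fun p : ℝ × Metric.sphere (0 : EuclideanSpace ℝ (Fin 4)) 1 =>
        (p.2 : EuclideanSpace ℝ (Fin 4))) :=
    contMDiff_val_sphere3.comp contMDiff_snd
  have h3 : ContMDiff (𝓘(ℝ, ℝ).prod (𝓡 3)) 𝓘(ℝ, EuclideanSpace ℝ (Fin 4)) ∞
      (fun p : ℝ × Metric.sphere (0 : EuclideanSpace ℝ (Fin 4)) 1 =>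
        ρ p.1 • (p.2 : EuclideanSpace ℝ (Fin 4))) := by
    have hF : ContDiff ℝ ∞ fun q : ℝ × EuclideanSpace ℝ (Fin 4) => q.1 • q.2 :=
      contDiff_fst.smul contDiff_snd
    exact hF.comp_contMDiff (h1.prodMk_space h2)
  exact hG.comp_contMDiff h3

/-- Each stage is smooth. -/
theorem contMDiff_radialSphere (hG : ContDiff ℝ ∞ G) (r : ℝ) :
    ContMDiff (𝓡 3) (𝓡 4) ∞ (radialSphere G r) := by
  have h := contMDiff_uncurry_radialSphere hG (contDiff_const (c := r))
  have h2 : ContMDiff (𝓡 3) (𝓘(ℝ, ℝ).prod (𝓡 3)) ∞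
      (fun x : Metric.sphere (0 : EuclideanSpace ℝ (Fin 4)) 1 => ((0 : ℝ), x)) :=
    contMDiff_const.prodMk contMDiff_id
  exact h.comp h2

/-- A stage is injective when `G` is injective on the sphere of radius `r > 0`. -/
theorem injective_radialSphere {r : ℝ} (hr : 0 < r) (hinj : InjOn G (Metric.sphere 0 r)) :
    Injective (radialSphere G r) := by
  intro x y h
  have hx : r • (x : EuclideanSpace ℝ (Fin 4)) ∈ Metric.sphere (0 : EuclideanSpace ℝ (Fin 4)) r := by
    rw [mem_sphere_zero_iff_norm, norm_smul, Real.norm_eq_abs, abs_of_pos hr, norm_eq_of_mem_sphere x,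
      mul_one]
  have hy : r • (y : EuclideanSpace ℝ (Fin 4)) ∈ Metric.sphere (0 : EuclideanSpace ℝ (Fin 4)) r := by
    rw [mem_sphere_zero_iff_norm, norm_smul, Real.norm_eq_abs, abs_of_pos hr, norm_eq_of_mem_sphere y,
      mul_one]
  have := hinj hx hy h
  exact Subtype.ext (smul_right_injective _ hr.ne' this)

/-- **Each stage is an immersion of `S³`** when every tangent vector of the sphere of radius
`r ≠ 0` killed by `dG` vanishes (the kernel hypothesis: `G` immersive there, or a fold with
transverse kernel). [folklore] -/
theorem injective_mfderiv_radialSphere (hG : ContDiff ℝ ∞ G) {r : ℝ} (hr : r ≠ 0)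
    (hker : ∀ u w : EuclideanSpace ℝ (Fin 4), ‖u‖ = |r| → ⟪u, w⟫ = 0 → fderiv ℝ G u w = 0 → w = 0)
    (x : Metric.sphere (0 : EuclideanSpace ℝ (Fin 4)) 1) :
    Injective (mfderiv (𝓡 3) (𝓡 4) (radialSphere G r) x) := by
  -- the stage is `(G ∘ L) ∘ val` with `L = r • id`
  set L : EuclideanSpace ℝ (Fin 4) →L[ℝ] EuclideanSpace ℝ (Fin 4) :=
    r • ContinuousLinearMap.id ℝ (EuclideanSpace ℝ (Fin 4)) with hL
  have hfun : radialSphere G r = (G ∘ L) ∘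
      (Subtype.val : Metric.sphere (0 : EuclideanSpace ℝ (Fin 4)) 1 → EuclideanSpace ℝ (Fin 4)) := by
    funext y
    simp [radialSphere, hL]
  have hval : HasMFDerivAt (𝓡 3) 𝓘(ℝ, EuclideanSpace ℝ (Fin 4))
      (Subtype.val : Metric.sphere (0 : EuclideanSpace ℝ (Fin 4)) 1 → EuclideanSpace ℝ (Fin 4)) x
      (mfderiv (𝓡 3) 𝓘(ℝ, EuclideanSpace ℝ (Fin 4))
        (Subtype.val : Metric.sphere (0 : EuclideanSpace ℝ (Fin 4)) 1 → EuclideanSpace ℝ (Fin 4)) x) :=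
    ((contMDiff_val_sphere3 x).mdifferentiableAt (by simp)).hasMFDerivAt
  have hGL : HasFDerivAt (G ∘ L) ((fderiv ℝ G (L x)).comp L) (x : EuclideanSpace ℝ (Fin 4)) :=
    ((hG.differentiable (by simp)) (L x)).hasFDerivAt.comp _ L.hasFDerivAt
  have hcomp := hGL.hasMFDerivAt.comp x hval
  rw [hfun, hcomp.mfderiv]
  intro v₁ v₂ h
  apply mfderiv_coe_sphere_injective (n := 3) (E := EuclideanSpace ℝ (Fin 4)) x
  set D := mfderiv (𝓡 3) 𝓘(ℝ, EuclideanSpace ℝ (Fin 4))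
    (Subtype.val : Metric.sphere (0 : EuclideanSpace ℝ (Fin 4)) 1 → EuclideanSpace ℝ (Fin 4)) x with hD
  have htan : ∀ v, (D v : EuclideanSpace ℝ (Fin 4)) ∈
      (ℝ ∙ ((x : Metric.sphere (0 : EuclideanSpace ℝ (Fin 4)) 1) : EuclideanSpace ℝ (Fin 4)))ᗮ := by
    intro v
    rw [← range_mfderiv_coe_sphere (n := 3) x]
    exact ⟨v, rfl⟩
  -- a tangent vector `w ⊥ x` with `dG(r x) (r • w) = 0` vanishes
  have hnorm : ‖L x‖ = |r| := by
    simp [hL, norm_smul, norm_eq_of_mem_sphere x]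
  have key : ∀ w : EuclideanSpace ℝ (Fin 4),
      w ∈ (ℝ ∙ ((x : Metric.sphere (0 : EuclideanSpace ℝ (Fin 4)) 1) : EuclideanSpace ℝ (Fin 4)))ᗮ →
        fderiv ℝ G (L x) (L w) = 0 → w = 0 := by
    intro w hw hzero
    rw [Submodule.mem_orthogonal_singleton_iff_inner_right] at hw
    have horth : ⟪L x, L w⟫ = 0 := by
      have hLw : L w = r • w := by simp [hL]
      have hLx : L (x : EuclideanSpace ℝ (Fin 4)) = r • (x : EuclideanSpace ℝ (Fin 4)) := by simp [hL]
      rw [hLw, hLx, real_inner_smul_left, real_inner_smul_right, hw, mul_zero, mul_zero]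
    have hLw := hker _ _ hnorm horth hzero
    have h1 : L w = r • w := by simp [hL]
    rw [h1] at hLw
    exact (smul_eq_zero.1 hLw).resolve_left hr
  have hsub := key _ (Submodule.sub_mem _ (htan v₁) (htan v₂)) ?_
  · exact sub_eq_zero.1 hsub
  · have h' : fderiv ℝ G (L x) (L (D v₁)) = fderiv ℝ G (L x) (L (D v₂)) := h
    rw [map_sub, map_sub, h', sub_self]

/-- **Each stage is a `C^∞` embedding `S³ ↪ ℝ⁴`** (Hirsch's criterion on the compact sphere). -/
theorem isSmoothEmbedding_radialSphere (hG : ContDiff ℝ ∞ G) {r : ℝ} (hr : 0 < r)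
    (hinj : InjOn G (Metric.sphere 0 r))
    (hker : ∀ u w : EuclideanSpace ℝ (Fin 4), ‖u‖ = r → ⟪u, w⟫ = 0 → fderiv ℝ G u w = 0 → w = 0) :
    Manifold.IsSmoothEmbedding (𝓡 3) (𝓡 4) ∞ (radialSphere G r) :=
  Literature.Topology.FourManifolds.isSmoothEmbedding_of_injective_of_injective_mfderiv
    (contMDiff_radialSphere hG r) (by simp) (injective_radialSphere hr hinj)
    (injective_mfderiv_radialSphere hG hr.ne' (by rw [abs_of_pos hr]; exact hker))

/-- **Clean pleats have injective chart shadow on every sphere up to the collar**: with `ε` the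
cleanness width, `G` is injective on `S_r` for all `0 < r ≤ 2 + ε` (each sphere lies in one of
the three closed pieces). -/
theorem injOn_sphere_of_clean {ε : ℝ}
    (h1 : InjOn G (Metric.closedBall 0 1))
    (h2 : InjOn G (Metric.closedBall 0 2 \ Metric.ball 0 1))
    (h3 : InjOn G (Metric.closedBall 0 (2 + ε) \ Metric.ball 0 2))
    {r : ℝ} (hr1 : r ≤ 2 + ε) : InjOn G (Metric.sphere 0 r) := by
  by_cases ha : r ≤ 1
  · exact h1.mono (sphere_subset_closedBall.trans (closedBall_subset_closedBall ha))
  by_cases hb : r ≤ 2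
  · have hsub : Metric.sphere (0 : EuclideanSpace ℝ (Fin 4)) r ⊆
        Metric.closedBall 0 2 \ Metric.ball 0 1 := by
      intro u hu
      refine ⟨sphere_subset_closedBall.trans (closedBall_subset_closedBall hb) hu, ?_⟩
      rw [mem_sphere_zero_iff_norm] at hu
      rw [mem_ball_zero_iff, hu, not_lt]
      linarith
    exact h2.mono hsub
  · have hsub : Metric.sphere (0 : EuclideanSpace ℝ (Fin 4)) r ⊆
        Metric.closedBall 0 (2 + ε) \ Metric.ball 0 2 := by
      intro u hu
      refine ⟨sphere_subset_closedBall.trans (closedBall_subset_closedBall hr1) hu, ?_⟩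
      rw [mem_sphere_zero_iff_norm] at hu
      rw [mem_ball_zero_iff, hu, not_lt]
      linarith
    exact h3.mono hsub

end Stage

/-! ### The kernel hypothesis for the chart of a single pleat -/

section OnePleat

variable {M : Type} [TopologicalSpace M] [ChartedSpace (EuclideanSpace ℝ (Fin 4)) M]
  {ι : M → EuclideanSpace ℝ (Fin 5)} {δ : ℝ} {e : Fin 1 → EuclideanSpace ℝ (Fin 4) → M}

/-- Off the fold spheres the chart shadow of a `1`-pleat position is immersive. -/
theorem injective_fderiv_chartShadow (h : IsPleatedPosition ι δ e) {u : EuclideanSpace ℝ (Fin 4)}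
    (hu : u ∉ pleatSpheres) : Injective (fderiv ℝ (proj5 ∘ ι ∘ e 0) u) := by
  have hι := h.1
  have he := (h.2.2.2.2.1 0).1
  have hup : 1 - δ < ι (e 0 u) 4 := (h.2.2.2.2.1 0).2 u
  have hnot : e 0 u ∉ ⋃ j, e j '' pleatSpheres := by
    simp only [mem_iUnion, mem_image, not_exists, not_and]
    intro j v hv hvu
    obtain rfl : j = 0 := Subsingleton.elim j 0
    exact hu (he.isEmbedding.injective hvu ▸ hv)
  have hsh := h.2.2.2.2.2.2.1 (e 0 u) hup hnot
  have hn : (∞ : WithTop ℕ∞) ≠ 0 := by simp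
  -- chain rule through the chart: `d(shadow ∘ e 0)_u = d(shadow)_{e 0 u} ∘ d(e 0)_u`
  have hcomp : mfderiv (𝓡 4) (𝓡 4) ((proj5 ∘ ι) ∘ e 0) u =
      (mfderiv (𝓡 4) (𝓡 4) (proj5 ∘ ι) (e 0 u)).comp (mfderiv (𝓡 4) (𝓡 4) (e 0) u) :=
    mfderiv_comp u ((contMDiff_shadow hι _).mdifferentiableAt hn)
      ((he.contMDiff u).mdifferentiableAt hn)
  have hfun : proj5 ∘ ι ∘ e 0 = (proj5 ∘ ι) ∘ e 0 := rfl
  rw [hfun, ← mfderiv_eq_fderiv, hcomp]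
  have h2 : Injective (mfderiv (𝓡 4) (𝓡 4) (e 0) u) :=
    Literature.Topology.FourManifolds.injective_mfderiv_of_isImmersionAt'
      (he.isImmersion.isImmersionAt u)
  intro a b hab
  exact h2 (hsh hab)

/-- **The kernel hypothesis for the chart of a `1`-pleat position**: at every `u ≠ 0`, a
vector `w ⊥ u` killed by the chart-shadow differential vanishes (off the fold spheres the
chart shadow is immersive; on them the fold kernel is transverse, file IV). [folklore] -/
theorem chartShadow_kernel (h : IsPleatedPosition ι δ e) (u w : EuclideanSpace ℝ (Fin 4))
    (huw : ⟪u, w⟫ = 0) (hw : fderiv ℝ (proj5 ∘ ι ∘ e 0) u w = 0) : w = 0 := by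
  by_cases hu : u ∈ pleatSpheres
  · exact eq_zero_of_fderiv_chartShadow_eq_zero h 0 hu huw hw
  · exact injective_fderiv_chartShadow h hu (by rw [hw, map_zero])

/-- The chart shadow of a pleated position is smooth. -/
theorem contDiff_chartShadow (h : IsPleatedPosition ι δ e) : ContDiff ℝ ∞ (proj5 ∘ ι ∘ e 0) := by
  rw [← coe_proj5L]
  exact proj5L.contDiff.comp (contDiff_chartMap h 0).1

/-- **The radial isotopy of a single pleat chart.**  If the chart shadow `G = proj5 ∘ ι ∘ e 0`
of a `1`-pleat position is injective on every sphere `S_r`, `r₀ ≤ r ≤ R` (`0 < r₀ ≤ R`), then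
`t ↦ G(radius r₀ R t • ·)` is a smooth isotopy of embeddings `S³ ↪ ℝ⁴` from the sphere of
radius `r₀` to the sphere of radius `R` — across the fold radii included. [folklore] -/
theorem smoothIsotopy_radial (h : IsPleatedPosition ι δ e) {r₀ R : ℝ} (hr₀ : 0 < r₀) (hR : r₀ ≤ R)
    (hinj : ∀ r, r₀ ≤ r → r ≤ R → InjOn (proj5 ∘ ι ∘ e 0) (Metric.sphere 0 r)) :
    Nonempty (Literature.Topology.FourManifolds.SmoothIsotopy (𝓡 3) (𝓡 4)
      (radialSphere (proj5 ∘ ι ∘ e 0) r₀) (radialSphere (proj5 ∘ ι ∘ e 0) R)) := by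
  have hG := contDiff_chartShadow h
  refine ⟨{ toFun := fun t => radialSphere (proj5 ∘ ι ∘ e 0) (radius r₀ R t)
            contMDiff := contMDiff_uncurry_radialSphere hG (contDiff_radius r₀ R)
            isSmoothEmbedding := fun t => ?_
            map_zero := by funext x; simp [radialSphere]
            map_one := by funext x; simp [radialSphere] }⟩
  obtain ⟨h1, h2⟩ := radius_mem_Icc hR t
  have hpos : 0 < radius r₀ R t := lt_of_lt_of_le hr₀ h1
  exact isSmoothEmbedding_radialSphere hG hpos (hinj _ h1 h2)
    (fun u w hu huw hw => chartShadow_kernel h u w huw hw)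

/-- The radial isotopy of a CLEAN single pleat, from any `r₀ > 0` to any `R ≤ 2 + ε`. -/
theorem smoothIsotopy_radial_of_isCleanPleat (h : IsPleatedPosition ι δ e) (hc : IsCleanPleat ι (e 0)) :
    ∃ ε : ℝ, 0 < ε ∧
      InjOn (proj5 ∘ ι ∘ e 0) (Metric.closedBall 0 (2 + ε) \ Metric.ball 0 2) ∧
      ∀ r₀ R : ℝ, 0 < r₀ → r₀ ≤ R → R ≤ 2 + ε →
        Nonempty (Literature.Topology.FourManifolds.SmoothIsotopy (𝓡 3) (𝓡 4)
          (radialSphere (proj5 ∘ ι ∘ e 0) r₀) (radialSphere (proj5 ∘ ι ∘ e 0) R)) := by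
  obtain ⟨ε, hε, h1, h2, h3, -, -⟩ := hc
  refine ⟨ε, hε, h3, fun r₀ R hr₀ hR hRε => smoothIsotopy_radial h hr₀ hR fun r _ hrR => ?_⟩
  exact injOn_sphere_of_clean h1 h2 h3 (hrR.trans hRε)

end OnePleat

end Summit.SmoothPoincare4.SmoothPoincare4.Theorems.OrigamiFoldExistence.ShadowPleats

end
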